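import Literature.Barriers.Schanuel.LargeTranscendenceDegreeOfCriterion
import HarnessLib

/-!
# Large transcendence degree on the `d × ℓ` grid (LNM 1752, Ch. 14, Theorem 2.7) — discharged

Discharge of the named fact (barrier declaration)
`Literature.Barriers.Schanuel.LargeTranscendenceDegree` (`LargeTranscendenceDegree.lean`;
Nesterenko–Philippon (eds.), LNM 1752, Ch. 14 (M. Waldschmidt), Theorem 2.7, p. 215 = PDF p. 248,
"Here is the main result of G. Diaz in [Dia2]"): for `ℚ`-linearly independent `x₁, …, x_d`
satisfying (T.H.) and `ℚ`-linearly independent `y₁, …, y_ℓ` satisfying (T.H.), with `dℓ > ℓ + d`,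
`K = ℚ(e^{xᵢyⱼ})`, `K₁ = K(x)`, `K₂ = K₁(y)`:
`trdeg K ≥ [dℓ/(ℓ+d)]`, `trdeg K₁ ≥ [d(ℓ+1)/(ℓ+d)]`, `trdeg K₂ ≥ ⌈dℓ/(ℓ+d)⌉`.

Proofs only (no definitions, no named facts, nothing asserted). This file only composes theorems
already in the tree:

* `largeTranscendenceDegree_of_nesterenko` (`LargeTranscendenceDegreeOfCriterion.lean`): the
  barrier declaration from the three core elimination-theoretic facts of LNM 1752, Ch. 3 §4 —
  Prop. 4.4 (associated form), Prop. 4.11 (Bézout inequality), Prop. 4.13 (close zero) — through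
  Philippon's main criterion (`Philippon1986_mainCriterion_of_nesterenko'`), Philippon's zero
  estimate on `𝔾ₐ × 𝔾ₘⁿ` (`Philippon1986_GaGm_P1n_holds`, `Philippon1986_GaGm_holds`), Diaz's
  Théorèmes 1, 2 (`Diaz1989_thm1_of_philippon`, `Diaz1989_thm2_of_philippon`) and Laurent's
  Théorème 3 iii) for the `t₂`-clause (`Diaz1989_main_iii_of_mainCriterion`,
  `Diaz1989_gridXY_of_main`);
* the tree's discharges of those three facts:
  `Nesterenko.NesterenkoPhilippon2001_ch3_prop_4_4_holds` (`NesterenkoEliminationProp44Holds.lean`),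
  `Nesterenko.NesterenkoPhilippon2001_ch3_prop_4_11_holds` (`NesterenkoEliminationProp411Holds.lean`),
  `Nesterenko.NesterenkoPhilippon2001_ch3_prop_4_13_holds` (`NesterenkoEliminationProp413Holds.lean`)
  (all three already imported here through `DiazMainIIIOfCriterion.lean`, where they give
  `Diaz1989_main_iii_holds`).

So Theorem 2.7 — the printed reach of the Gel'fond–Schneider method in several variables under the
Technical Hypothesis, recorded by the barrier — is now a theorem of the tree rather than a
hypothesis: users' `(h : LargeTranscendenceDegree)` / `(h : diaz1989_largeTrdeg)` are fed
`LargeTranscendenceDegree_holds` / `diaz1989_largeTrdeg_holds`. A new sibling is used (rather than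
an append to `LargeTranscendenceDegree.lean`) because the statement file sits below all the proofs
files in the import order (same layout as `LargeTranscendenceDegreeThm29Holds.lean` for Theorem 2.9).

## References

* [NesterenkoPhilippon2001] Yu. V. Nesterenko, P. Philippon (eds.), *Introduction to Algebraic
  Independence Theory*, LNM 1752, Springer (2001): Ch. 14 (M. Waldschmidt), Definition 2.6 and
  Theorem 2.7 with its Remark, p. 215 (PDF p. 248), §2.3 p. 217 (PDF p. 250); Ch. 3
  (Yu. V. Nesterenko) §4, Prop. 4.4 (p. 38), Prop. 4.11 (pp. 40–41), Prop. 4.13 (p. 41).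
* [Diaz1989] G. Diaz, *Grands degrés de transcendance pour des familles d'exponentielles*,
  J. Number Theory 31 (1989) 1–23, Théorèmes 1, 2.
* [Philippon1986Criteres] P. Philippon, *Critères pour l'indépendance algébrique*, Publ. Math.
  IHÉS 64 (1986) 5–52, Théorème 2.11, Théorème 2.12 (i).
* [Laurent1991] M. Laurent, *Sur quelques résultats récents de transcendance*, Astérisque 198–200
  (1991) 209–230, §3.1, Théorème 3 iii).
-/

noncomputable section

namespace Literature.Barriers.Schanuel

open Literature.NumberTheory.Transcendental

/-- **LNM 1752, Ch. 14, Theorem 2.7 (Diaz 1989 — large transcendence degree under the Technical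
Hypothesis), PROVED**: the named fact `LargeTranscendenceDegree` holds — for `ℚ`-linearly
independent `x : Fin d → ℂ` and `y : Fin ℓ → ℂ` both satisfying (T.H.) and `ℓ + d < dℓ`,
`[dℓ/(ℓ+d)] ≤ trdeg_ℚ ℚ(e^{xᵢyⱼ})`, `[d(ℓ+1)/(ℓ+d)] ≤ trdeg_ℚ ℚ(x, e^{xᵢyⱼ})`,
`⌈dℓ/(ℓ+d)⌉ ≤ trdeg_ℚ ℚ(x, y, e^{xᵢyⱼ})`. Composition of the tree's reduction
`largeTranscendenceDegree_of_nesterenko` (Theorem 2.7 from LNM 1752 Ch. 3 §4, Prop. 4.4, 4.11,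
4.13, via Philippon's criterion and zero estimate, Diaz's Théorèmes 1, 2 and Laurent's
Théorème 3 iii)) with the tree's discharges of those three propositions.
[cite: NesterenkoPhilippon2001, Ch. 14 Theorem 2.7 and Remark, p. 215 (PDF p. 248); Ch. 3 §4 Prop. 4.4, 4.11, 4.13]
[cite: Diaz1989, Théorèmes 1, 2] -/
theorem LargeTranscendenceDegree_holds : LargeTranscendenceDegree :=
  largeTranscendenceDegree_of_nesterenko
    Nesterenko.NesterenkoPhilippon2001_ch3_prop_4_4_holds
    Nesterenko.NesterenkoPhilippon2001_ch3_prop_4_11_holds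
    Nesterenko.NesterenkoPhilippon2001_ch3_prop_4_13_holds

/-- The same theorem under the literature-style second name of the barrier declaration,
`diaz1989_largeTrdeg` (an `alias` of `LargeTranscendenceDegree`; `largeTranscendenceDegree_iff` is
`Iff.rfl`), for users written against that spelling (route theses `Schanuel/AlgIndepMethod`,
`Schanuel/RoyCriterion`). [cite: NesterenkoPhilippon2001, Ch. 14 Theorem 2.7]
[cite: Diaz1989, Théorèmes 1, 2] -/
theorem diaz1989_largeTrdeg_holds : diaz1989_largeTrdeg :=
  LargeTranscendenceDegree_holds

/-- **Theorem 2.7, clause `t`, unconditionally in the tree**: under (T.H.) for `x` and `y`,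
`ℓ + d < dℓ` gives `[dℓ/(ℓ+d)] ≤ trdeg_ℚ ℚ(e^{xᵢyⱼ})`.
[cite: NesterenkoPhilippon2001, Ch. 14 Theorem 2.7 (t) and Remark] -/
theorem le_trdeg_gridField {d l : ℕ} (x : Fin d → ℂ) (y : Fin l → ℂ)
    (hx : LinearIndependent ℚ x) (hTx : TechnicalHypothesis x)
    (hy : LinearIndependent ℚ y) (hTy : TechnicalHypothesis y) (hdl : l + d < d * l) :
    ((d * l / (l + d) : ℕ) : Cardinal) ≤ Algebra.trdeg ℚ (gridField x y) :=
  (LargeTranscendenceDegree_holds d l x y hx hTx hy hTy hdl).1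

/-- **Theorem 2.7, clause `t₁`, unconditionally in the tree**: under (T.H.) for `x` and `y`,
`ℓ + d < dℓ` gives `[d(ℓ+1)/(ℓ+d)] ≤ trdeg_ℚ ℚ(x, e^{xᵢyⱼ})`.
[cite: NesterenkoPhilippon2001, Ch. 14 Theorem 2.7 (t₁) and Remark] -/
theorem le_trdeg_gridField₁ {d l : ℕ} (x : Fin d → ℂ) (y : Fin l → ℂ)
    (hx : LinearIndependent ℚ x) (hTx : TechnicalHypothesis x)
    (hy : LinearIndependent ℚ y) (hTy : TechnicalHypothesis y) (hdl : l + d < d * l) :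
    ((d * (l + 1) / (l + d) : ℕ) : Cardinal) ≤ Algebra.trdeg ℚ (gridField₁ x y) :=
  (LargeTranscendenceDegree_holds d l x y hx hTx hy hTy hdl).2.1

/-- **Theorem 2.7, clause `t₂`, unconditionally in the tree** (Philippon 1986, Théorème 2.12 (i)):
under (T.H.) for `x` and `y`, `ℓ + d < dℓ` gives `⌈dℓ/(ℓ+d)⌉ ≤ trdeg_ℚ ℚ(x, y, e^{xᵢyⱼ})`.
[cite: NesterenkoPhilippon2001, Ch. 14 Theorem 2.7 (t₂) and §2.3 p. 217]
[cite: Philippon1986Criteres, Théorème 2.12 (i)] -/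
theorem ceil_le_trdeg_gridField₂ {d l : ℕ} (x : Fin d → ℂ) (y : Fin l → ℂ)
    (hx : LinearIndependent ℚ x) (hTx : TechnicalHypothesis x)
    (hy : LinearIndependent ℚ y) (hTy : TechnicalHypothesis y) (hdl : l + d < d * l) :
    ((⌈((d * l : ℕ) : ℚ) / ((l + d : ℕ) : ℚ)⌉₊ : ℕ) : Cardinal) ≤ Algebra.trdeg ℚ (gridField₂ x y) :=
  (LargeTranscendenceDegree_holds d l x y hx hTx hy hTy hdl).2.2

end Literature.Barriers.Schanuel

end
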